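import Mathlib
import Literature.MathematicalPhysics.QuantumFieldTheory.Balaban1983to89.B6Prop23KernelInput

/-!
# `Balaban1983to89.B6Prop23MajorantInput` — the edge Proposition 2.2 (2.67) → Proposition 2.3: the G′-majorant
inputs of the re-assembled Proposition 2.3 READ OFF the printed (2.67), and off the kernel-checked chain (2.64)–(2.66)

B6 = T. Bałaban, *Propagators and renormalization transformations for lattice gauge theories. II*, Commun. Math. Phys.
**96**, 223–250 (1984) [Balaban1984PropagatorsII].

CITATION HEADER (lean-in-tree rule 2026-08-18).  Cell `pub-balaban`, unit `b2b-balaban-b06-g12` (paper sub-cell B06,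
gen 12).  Imports: Mathlib + `…B6Prop23KernelInput` (p184899; its closure contains `…B6` with the verbatim typings
`B6.GpFamily` / `B6.Prop22Printed` of (2.67), `…B6RandomWalk` with `HasMajorant` / `BlockSupp`, and `…B6Prop23Chain`
with the chain `majorant_of_fixedPoint_266W`); nothing landed is modified.  Source: doi:10.1007/bf01240221, held
`paper:balaban1984-cmp96-propagators-rt-ii`; journal page = PDF page + 222; quotations read from the page renders
pp. 232, 234, 238.  Cell rows GAPS C-b06g12-10, DIVERGENCE D-b06.31; journal claim PROP23-MAJORANT-INPUT.
(v1.1, unit `b2b-balaban-b06-g13`, DOCSTRINGS ONLY — declarations byte-identical to v1: the two records-only items of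
the cross-read certificate `b2b-balaban-pv09-g7/XREAD-B6Prop23MajorantInput-v1.md` — R1 the (2.66) quotation of §2 now
carries the printed ½ in e^{−½δ₀d(y,y′)} (p. 234 re-read as image), R2 the p. 238 quotation names the operators
*"G′, G′(□̃)"* as printed (□̃, not □); GAPS C-b06g13-1.)

THE PRINTED EDGE.  Proposition 2.2 p. 234: *"If we have (2.1), (2.2) and M is sufficiently large, then the operator
G′ = Δ′_a^{−1} (a = 1) satisfies the inequalities |(G′λ)(x)|, |(∇G′λ)(x)|, |(G′∇*λ)(x)|, ‖ζ∇G′λ‖_α, ‖ζG′∇*λ‖_α,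
|(ΔG′λ)(x)| ≤ O(1)[(L^jη)², L^jη, L^jη, (L^jη)^{1−α}(‖ζ‖_α + |ζ|), (L^jη)^{1−α}(‖ζ‖_α + |ζ|), 1]·e^{−½δ₀d(y,y′)}|λ|,
x ∈ B^j(y) or supp ζ ⊂ B^j(y), y ∈ Λ_j, supp λ ⊂ B^{j′}(y′), y′ ∈ Λ_{j′}. (2.67)"*; and p. 238, in the proof of
Proposition 2.3: *"This estimate follows from the random walk representations (2.50) for the operators G′, G′(□̃)."*
The re-assembled Proposition 2.3 of this lineage (`B6Prop23KernelInput.prop23_assembled_rw`, ≈ 70 located hypotheses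
⟹ (2.86)–(2.87)) consumes the FIRST entry of (2.67) for G′ and for every G′(□̃_i) as the block majorants
`hG : HasMajorant blk G′ (B₁(L^jη)²e^{−δd})`, `hGw i : HasMajorant blk G′(□̃_i) (same)` (B₁ = the O(1), δ = ½δ₀).

WHAT THIS MODULE PROVES (kernel-checked; no `sorry`, no axiom beyond Lean's three):
1. §1 THE DICTIONARY `hasMajorant_of_entry0`: in the verbatim typing of `…B6` the first entry of (2.67) is a NUMBER
   e₀(λ, y) attached to an abstract localized test function λ : `g.Loc` with abstract predicates `g.suppIn λ y′`
   (*"supp λ ⊂ B^{j′}(y′)"*) and `g.supNorm λ` (*"|λ|"*).  Under the located READING — (ιL) λ is a function on the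
   fine lattice, (hloc) every function supported in the block of y′ and bounded by B there is such a λ with
   supp λ ⊂ B^{j′}(y′) and |λ| ≤ B, (hval) e₀(λ, y) dominates |(G′λ)(x)| for x ∈ B^j(y) — the printed clause
   e₀(λ, y) ≤ O(1)(L^jη)²e^{−r d(y,y′)}|λ| IS the block majorant `HasMajorant blk G′ (O(1)·(L^jη)²·e^{−r d})`;
   `hasMajorant_of_prop22Printed`: hence `B6.Prop22Printed geo Gp` yields, with its witnesses (M₁, δ₀, C), the
   majorant C(L^jη)²e^{−½δ₀d} of every operator read through (Gp i).e 0, for every situation i with M_i ≥ M₁.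
2. §2 `hasMajorant_of_fixedPoint`: the OUTPUT of the kernel-checked chain (2.64)–(2.66) of the proof of Prop. 2.2
   (`B6Prop23Chain.majorant_of_fixedPoint_266W`, run with P(y) = (L^jη)²: G′ = G′₀ + G′R, |G′₀| ≺ A(L^jη)²e^{−δ₀d},
   |R| ≺ θe^{−δ₀d}, θc < 1, (2.61)/(2.63)) has EXACTLY the input type `hG` with B₁ = A c(1 − θc)⁻¹, δ = (1 − α)δ₀.
3. §3 **`prop23_assembled_p22`** = `prop23_assembled_rw` with `hG` and every `hGw i` DISCHARGED from the (2.67)₀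
   clauses for G′ and the G′(□̃_i) read through (ιL, hloc, hval); all other hypotheses and the conclusion verbatim.
   With §1 this closes the edge `B6.Prop22Printed` (entry 0, for G′ and the G′(□̃)) → `prop23_assembled_rw` →
   (`B6Prop23Printed.prop23Printed_of_assembled`) `B6.Prop23Printed`, modulo the located non-(2.67) hypotheses.
4. §4 `locGeo_reading`, `locGeo_majorant`: the reading (hloc, hval, (2.67)₀-clause) is CONSISTENT and is the
   intended one — on a two-site geometry whose `Loc` are the functions, `suppIn` = support in the block, `supNorm` =
   the sup norm, all three hold for G′ = 1 with e₀(λ, y) = |λ(y)|, O(1) = 1.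
HONEST SCOPE: the reading (hloc, hval) is a located interpretation of the abstract fields of `B6.Geometry`, not a
theorem about them; entries n = 1, 2, 3 and the Hölder entries of (2.67) are not consumed by Prop. 2.3 and not read
here; that G′(□̃) obeys (2.67) with the constants of G′ is the print's assertion p. 238 (located as `h267w`).
Value = certified DAG edge PROP22 → PROP23 of the paper, NOT summit progress.
-/

namespace Literature.MathematicalPhysics.QuantumFieldTheory.Balaban1983to89.B6Prop23MajorantInput

open Finset Real
open B4Sect5Torus (IsPseudoDist)
open B6DomainChange (Profile)
open B6RandomWalk (HasMajorant BlockSupp Ineq260)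
open B6RandomWalkHom (HasMajorantHom)
open B6DomainMajorant (Ctot eps1)
open B6Expansion282 (kerOp kerOp_apply locOp Cglued R282)
open B6Prop23Chain (mat majorant_of_fixedPoint_266W)
open B6Lemma21Repaired (Ineq261With Ineq263With)
open B6Ineq268 (LevelSep mx)
open B6Prop23Assembled (K285 kappa2 kappa3 kappa4)
open B6Prop23KernelInput (prop23_assembled_rw)

/-! ## §1  The dictionary: entry 0 of (2.67) in the typing of `…B6` ⟹ the block majorant -/

section Dictionary

variable {g : B6.Geometry} {X : Type}

/-- The prefactor table of (2.67) at entry 0 is (L^jη)². [cite: Balaban1984PropagatorsII, (2.67) p.234] -/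
theorem pref4_zero (t : ℝ) : B6.pref4 t 0 = t ^ 2 := by
  simp [B6.pref4]

/-- **ENTRY 0 OF (2.67) READ AS A BLOCK MAJORANT.**  p. 234 (2.67): *"|(G′λ)(x)| ≤ O(1)(L^jη)²e^{−½δ₀d(y,y′)}|λ|,
x ∈ B^j(y), y ∈ Λ_j, supp λ ⊂ B^{j′}(y′), y′ ∈ Λ_{j′}"*.  In the typing of `…B6` the left side is the number
`E λ y` on abstract λ : `g.Loc` with `g.suppIn λ y′` = *"supp λ ⊂ B^{j′}(y′)"* and `g.supNorm λ` = *"|λ|"*; read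
through (ιL) λ ↦ a function on the fine lattice, (hloc) every function supported in the block of y′ with bound B is
a λ with supp λ ⊂ B^{j′}(y′), |λ| ≤ B, (hval) E(λ, y) ≥ |(G′λ)(x)| for x ∈ B^j(y), the printed clause with constant
C ≥ 0 and any rate r gives `HasMajorant blk G′ (C(L^jη)²e^{−r d})` — the hypothesis `hG` of
`B6Prop23KernelInput.prop23_assembled_rw`. [cite: Balaban1984PropagatorsII, Prop. 2.2 (2.67) p.234] -/
theorem hasMajorant_of_entry0 (blk : X → g.Site) (G : Module.End ℝ (X → ℝ)) (ιL : g.Loc → X → ℝ)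
    (E : g.Loc → g.Site → ℝ) {C r : ℝ} (hC : 0 ≤ C)
    (hloc : ∀ (μ : X → ℝ) (y' : g.Site) (B : ℝ), BlockSupp blk μ y' B →
      ∃ lam, ιL lam = μ ∧ g.suppIn lam y' ∧ g.supNorm lam ≤ B)
    (hval : ∀ lam x, |G (ιL lam) x| ≤ E lam (blk x))
    (h267 : ∀ lam y y', g.suppIn lam y' →
      E lam y ≤ C * B6.pref4 (g.len y) 0 * Real.exp (-(r * g.dist y y')) * g.supNorm lam) :
    HasMajorant blk G (fun a b => C * g.len a ^ 2 * Real.exp (-(r * g.dist a b))) := by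
  intro y' μ B hμ x
  obtain ⟨lam, hlam, hsupp, hnorm⟩ := hloc μ y' B hμ
  have h1 := hval lam x
  rw [hlam] at h1
  have h2 := h267 lam (blk x) y' hsupp
  rw [pref4_zero] at h2
  show |G μ x| ≤ C * g.len (blk x) ^ 2 * Real.exp (-(r * g.dist (blk x) y')) * B
  have h3 : C * g.len (blk x) ^ 2 * Real.exp (-(r * g.dist (blk x) y')) * g.supNorm lam ≤
      C * g.len (blk x) ^ 2 * Real.exp (-(r * g.dist (blk x) y')) * B :=
    mul_le_mul_of_nonneg_left hnorm (by positivity)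
  exact h1.trans (h2.trans h3)

/-- **`B6.Prop22Printed` ⟹ THE MAJORANT (2.67)₁**, for every situation with M ≥ M₁ and every operator read through
entry 0 of the family: the verbatim printed Proposition 2.2 of `…B6` hands to Proposition 2.3 exactly its input
`hG` / `hGw i`, with B₁ = the printed O(1) and δ = ½δ₀. [cite: Balaban1984PropagatorsII, Prop. 2.2 (2.67) p.234] -/
theorem hasMajorant_of_prop22Printed {I : Type} (geo : I → B6.Geometry) (Gp : ∀ i, B6.GpFamily (geo i))
    (h22 : B6.Prop22Printed geo Gp) :
    ∃ M₁ δ₀ C : ℝ, 0 < M₁ ∧ 0 < δ₀ ∧ 0 < C ∧ ∀ i, (geo i).Hyp21_22 → M₁ ≤ (geo i).M →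
      ∀ (X : Type) (blk : X → (geo i).Site) (G : Module.End ℝ (X → ℝ)) (ιL : (geo i).Loc → X → ℝ),
        (∀ (μ : X → ℝ) (y' : (geo i).Site) (B : ℝ), BlockSupp blk μ y' B →
          ∃ lam, ιL lam = μ ∧ (geo i).suppIn lam y' ∧ (geo i).supNorm lam ≤ B) →
        (∀ lam x, |G (ιL lam) x| ≤ (Gp i).e 0 lam (blk x)) →
        HasMajorant blk G (fun a b => C * (geo i).len a ^ 2 * Real.exp (-(δ₀ / 2 * (geo i).dist a b))) := by
  obtain ⟨M₁, δ₀, C, Cα, hM₁, hδ₀, hC, hall⟩ := h22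
  refine ⟨M₁, δ₀, C, hM₁, hδ₀, hC, fun i hH hMi X blk G ιL hloc hval => ?_⟩
  exact hasMajorant_of_entry0 blk G ιL ((Gp i).e 0) hC.le hloc hval
    (fun lam y y' hs => (hall i hH hMi).1 0 lam y y' hs)

end Dictionary

/-! ## §2  The kernel-checked chain (2.64)–(2.66) delivers the same type -/

section Chain

variable {g : B6.Geometry} {X : Type}

/-- **THE CHAIN OUTPUT IS THE INPUT `hG`.**  p. 234 (2.66): *"and this implies finally for x ∈ B^j(y), supp λ ⊂
B^{j′}(y′), |(G′λ)(x)| ≤ Σ_n |(G′₀Rⁿλ)(x)| ≤ … ≤ O(1)(L^jη)²e^{−½δ₀d(y,y′)}|λ|"* — the lineage's kernel-checked chain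
`B6Prop23Chain.majorant_of_fixedPoint_266W` (generic (2.61)/(2.63) constant c) run with P(y) = (L^jη)², under
the pseudo-distance axioms: G′ = G′₀ + G′R with |G′₀| ≺ A(L^jη)²e^{−δ₀d}, |R| ≺ θe^{−δ₀d}, θc < 1 give
`HasMajorant blk G′ (B₁(L^jη)²e^{−δd})` with B₁ = A c(1 − θc)⁻¹, δ = (1 − α)δ₀ — verbatim the type of `hG`.
[cite: Balaban1984PropagatorsII, Prop. 2.2 (2.64)–(2.67) p.234] -/
theorem hasMajorant_of_fixedPoint [Fintype X] [DecidableEq X] (blk : X → g.Site) (c δ₀ α θ A : ℝ)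
    (hA : 0 ≤ A) (hθ : 0 ≤ θ) (hc : 0 ≤ c) (hαδ : 0 ≤ (1 - α) * δ₀) (hρ : IsPseudoDist g.dist)
    (h261 : Ineq261With c g δ₀ α) (h263 : Ineq263With c g δ₀ α) (hsmall : θ * c < 1)
    {G' G0 R : Module.End ℝ (X → ℝ)}
    (hG0 : HasMajorant blk G0 (fun a b => A * g.len a ^ 2 * Real.exp (-(δ₀ * g.dist a b))))
    (hR : HasMajorant blk R (fun a b => θ * Real.exp (-(δ₀ * g.dist a b)))) (hfix : G' = G0 + G' * R) :
    HasMajorant blk G'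
      (fun a b => A * c * (1 - θ * c)⁻¹ * g.len a ^ 2 * Real.exp (-((1 - α) * δ₀ * g.dist a b))) :=
  majorant_of_fixedPoint_266W blk c δ₀ α θ A (fun a => g.len a ^ 2) hA (fun _ => sq_nonneg _) hθ hc hαδ
    hρ.triangle hρ.zero hρ.nonneg h261 h263 hsmall hG0 hR hfix

end Chain

/-! ## §3  Proposition 2.3 re-assembled with its G′-majorants read off (2.67) -/

section Reassembly

variable {g : B6.Geometry} [DecidableEq g.Site] {X : Type} {ι : Type} [Fintype ι] [DecidableEq ι]

/-- **PROPOSITION 2.3 WITH ITS (2.67)-INPUTS READ OFF THE PRINT** (p. 234 (2.67) + p. 238 *"This estimate follows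
from the random walk representations (2.50) for the operators G′, G′(□̃)"* ⇒ (2.68) ⇒ (2.85) ⇒ Lemma 2.1 ⇒
(2.86)–(2.87)): `B6Prop23KernelInput.prop23_assembled_rw` with ITS block-majorant inputs `hG`, `hGw i` DISCHARGED by
`hasMajorant_of_entry0` from the entry-0 clauses of (2.67) for G′ (`h267`) and for every G′(□̃_i) (`h267w`), read
through the located interpretation (ιL, hloc, hval/hvalw) of the abstract (Loc, suppIn, supNorm) of `…B6`; B₁ = the
printed O(1), δ = the printed ½δ₀.  Every other hypothesis and the conclusion are verbatim those of
`prop23_assembled_rw`. [cite: Balaban1984PropagatorsII, Proposition 2.3 (2.85)–(2.87) p.238; Prop. 2.2 (2.67) p.234] -/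
theorem prop23_assembled_p22 (d : ℕ) (hρ : IsPseudoDist g.dist) (hsep : LevelSep g) (hL : 1 ≤ g.L)
    (hη : 0 < g.eta) (hM : 0 < g.M) (hRM : 0 ≤ g.R * g.M)
    -- the fine-lattice side: blocks, (2.60), the (2.61) profile, the located size condition
    (blk : X → g.Site) {δ₀ α' : ℝ} (h260 : B6RandomWalk.Ineq260 g δ₀ α') {K : ℝ → ℝ}
    (hK : ∀ a, 0 < a → 0 ≤ K a) (hPr : Profile g.dist (fun a : g.Site => a) K) (hα' : 0 ≤ α' * δ₀)
    (hsize : g.L ^ 2 * Real.exp (-(α' * δ₀ * (g.R * g.M))) ≤ 1)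
    {δ B₁ θ : ℝ} (hκδ : α' * δ₀ < δ) (hB₁ : 0 ≤ B₁) (hθ : 0 ≤ θ)
    -- the constants of the assembled Prop. 2.3 (its δ₀ is (δ − α′δ₀)/3 here)
    {δ₁ σ cσ c c₃ s mg BC : ℝ} (hδ₁ : 0 ≤ δ₁) (hsplit : δ₁ + σ * ((δ - α' * δ₀) / 3) ≤ (δ - α' * δ₀) / 3 / 4)
    (h261σ : Ineq261With cσ g ((δ - α' * δ₀) / 3) σ)
    (hthr : g.L ^ 4 ≤ Real.exp (1 / 8 * ((δ - α' * δ₀) / 3) * g.R * g.M))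
    (h261 : Ineq261With c g δ₁ (1 / 2)) (h263 : Ineq263With c g δ₁ (1 / 2)) (hc : 0 ≤ c)
    (hc₃ : 0 < c₃) (hs : 0 ≤ s) (hmg : 0 < mg) (hBC : 0 ≤ BC)
    -- the cubes □_i = pf i, the partition of unity h_i = hf i, the kernels X, X̃_i, C_i in the pairing (2.69)
    {pf hf : ι → g.Site → ℝ} {js : ι → ℕ} {n₀ : ℕ} {Xk : g.Site → g.Site → ℝ}
    {Xwk Ck : ι → g.Site → g.Site → ℝ}
    (hover : ∀ y, (Finset.univ.filter fun i => hf i y ≠ 0).card ≤ n₀)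
    (hpf01 : ∀ i y, pf i y = 0 ∨ pf i y = 1) (hph : ∀ i y, pf i y * hf i y = hf i y)
    (h236 : ∀ y, ∑ i, hf i y ^ 2 = 1) (hLip : ∀ i y y'', |hf i y - hf i y''| ≤ s / g.M * g.dist y y'')
    (hcube : ∀ i y, pf i y ≠ 0 → js i ≤ g.scale y ∧ g.scale y ≤ js i + 1)
    (hlev : ∀ i y y', hf i y ≠ 0 → hf i y' ≠ 0 → g.scale y = g.scale y')
    (hgap : ∀ i y y'', pf i y = 0 → hf i y'' ≠ 0 → mg * g.M ≤ g.dist y y'')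
    (h281 : ∀ i y y', pf i y ≠ 0 → pf i y' ≠ 0 →
      |Ck i y y'| ≤ BC / (g.L ^ js i * g.eta) ^ (d + 4) * Real.exp (-(δ₁ * g.dist y y')))
    (hCk0 : ∀ i y'' y', pf i y'' = 0 → Ck i y'' y' = 0)
    (h270 : ∀ i, locOp (fun i => B6Expansion282.mulOp (pf i)) (fun i => kerOp (fun z => g.len z ^ d) (Xwk i)) i *
      kerOp (fun z => g.len z ^ d) (Ck i) * B6Expansion282.mulOp (hf i) = B6Expansion282.mulOp (hf i))
    -- the fine-lattice data of each cube: zone N_i, cut-off χ_i, D_i, G′(□̃_i) = Gw i; G′ = G, Q′ = Qp, Q′* = Qs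
    (N : ι → Finset g.Site) (hN : ∀ i, (N i).Nonempty)
    {G : Module.End ℝ (X → ℝ)} {Dop Gw : ι → Module.End ℝ (X → ℝ)} {χ : ι → X → ℝ}
    (hχ1 : ∀ i x, |χ i x| ≤ 1)
    (hpfχ : ∀ i x, pf i (blk x) * χ i x = pf i (blk x)) (hhχ : ∀ i x, χ i x * hf i (blk x) = hf i (blk x))
    (hχN : ∀ i x, blk x ∉ N i → χ i x = 1)
    (hGD : ∀ i, G * Dop i = 1) (hDG : ∀ i, Dop i * G = 1)
    (hχGw : ∀ i, B9Thm37Sum.mulOp (χ i) * Dop i * Gw i = B9Thm37Sum.mulOp (χ i))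
    (hGwχ : ∀ i, Gw i * Dop i * B9Thm37Sum.mulOp (χ i) = B9Thm37Sum.mulOp (χ i))
    -- (2.67)₀ for G′ and for every G′(□̃_i), in the verbatim typing of `…B6` read through (ιL, hloc, hval):
    (ιL : g.Loc → X → ℝ)
    (hloc : ∀ (μ : X → ℝ) (y' : g.Site) (B : ℝ), BlockSupp blk μ y' B →
      ∃ lam, ιL lam = μ ∧ g.suppIn lam y' ∧ g.supNorm lam ≤ B)
    (E : g.Loc → g.Site → ℝ) (Ew : ι → g.Loc → g.Site → ℝ)
    (hval : ∀ lam x, |G (ιL lam) x| ≤ E lam (blk x)) (hvalw : ∀ i lam x, |Gw i (ιL lam) x| ≤ Ew i lam (blk x))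
    (h267 : ∀ lam y y', g.suppIn lam y' →
      E lam y ≤ B₁ * B6.pref4 (g.len y) 0 * Real.exp (-(δ * g.dist y y')) * g.supNorm lam)
    (h267w : ∀ i lam y y', g.suppIn lam y' →
      Ew i lam y ≤ B₁ * B6.pref4 (g.len y) 0 * Real.exp (-(δ * g.dist y y')) * g.supNorm lam)
    (hKGw : ∀ i, HasMajorant blk ((B9Thm37Sum.mulOp (χ i) * Dop i - Dop i * B9Thm37Sum.mulOp (χ i)) * Gw i)
      (fun a b => (if a ∈ N i then θ else 0) * Real.exp (-(δ * g.dist a b))))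
    (hKG : ∀ i, HasMajorant blk ((B9Thm37Sum.mulOp (χ i) * Dop i - Dop i * B9Thm37Sum.mulOp (χ i)) * G)
      (fun a b => (if a ∈ N i then θ else 0) * Real.exp (-(δ * g.dist a b))))
    {M₀ : ℝ} (hpfdeep : ∀ i y, pf i y ≠ 0 → ∀ n ∈ N i, M₀ ≤ g.dist y n)
    (hhdeep : ∀ i y, hf i y ≠ 0 → ∀ n ∈ N i, M₀ ≤ g.dist y n)
    {Qp : (X → ℝ) →ₗ[ℝ] (g.Site → ℝ)} {Qs : (g.Site → ℝ) →ₗ[ℝ] (X → ℝ)} {cQ cQs : ℝ} (hcQ : 0 ≤ cQ)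
    (hcQs : 0 ≤ cQs)
    (hQ : HasMajorantHom blk (fun y : g.Site => y) Qp (fun (a b : g.Site) => cQ * (if a = b then (1 : ℝ) else 0)))
    (hQs : HasMajorantHom (fun y : g.Site => y) blk Qs (fun (a b : g.Site) => cQs * (if a = b then (1 : ℝ) else 0)))
    (hQχ : ∀ i, (B9Thm37Sum.mulOp (pf i) : Module.End ℝ (g.Site → ℝ)) ∘ₗ Qp =
      Qp ∘ₗ (B9Thm37Sum.mulOp (pf i ∘ blk) : Module.End ℝ (X → ℝ)))
    (hQsh : ∀ i, Qs ∘ₗ (B9Thm37Sum.mulOp (hf i) : Module.End ℝ (g.Site → ℝ)) =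
      (B9Thm37Sum.mulOp (hf i ∘ blk) : Module.End ℝ (X → ℝ)) ∘ₗ Qs)
    -- the dictionary (definitions of X, X̃_i as the (2.69)-kernels of Q′G′²Q′*, Q′G′(□̃_i)²Q′*) and the depth
    (hXdef : kerOp (fun z => g.len z ^ d) Xk = Qp ∘ₗ (G * G) ∘ₗ Qs)
    (hXwdef : ∀ i, kerOp (fun z => g.len z ^ d) (Xwk i) = Qp ∘ₗ (Gw i * Gw i) ∘ₗ Qs)
    (hM₀ : c₃ * g.M ≤ (δ - α' * δ₀) / 3 * M₀)
    -- «M large enough», with B_X := c_Q c_{Q*} B₁² L² K(δ/2) and B_D := c_Q c_{Q*} L² C_tot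
    (hKM : 2 * K285 g d n₀ s ((δ - α' * δ₀) / 3) cσ c₃ mg (cQ * cQs * (B₁ ^ 2 * (g.L ^ 2 * K (δ / 2))))
      (cQ * cQs * (g.L ^ 2 * Ctot K B₁ θ (δ - α' * δ₀))) BC * c ≤ g.M) :
    ∃ Ginv : Module.End ℝ (g.Site → ℝ),
      Ginv * kerOp (fun z => g.len z ^ d) Xk = 1 ∧ kerOp (fun z => g.len z ^ d) Xk * Ginv = 1 ∧
      Ginv = Cglued (fun i => B6Expansion282.mulOp (hf i)) (fun i => kerOp (fun z => g.len z ^ d) (Ck i)) +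
        Ginv * R282 (kerOp (fun z => g.len z ^ d) Xk) (fun i => B6Expansion282.mulOp (pf i))
          (fun i => kerOp (fun z => g.len z ^ d) (Xwk i)) (fun i => B6Expansion282.mulOp (hf i))
          (fun i => kerOp (fun z => g.len z ^ d) (Ck i)) ∧
      (∀ G' : Module.End ℝ (g.Site → ℝ), G' * kerOp (fun z => g.len z ^ d) Xk = 1 → G' = Ginv) ∧
      ∀ y y', |mat Ginv y y' / g.len y' ^ d| ≤
        2 * (n₀ * (BC * g.L ^ (d + 4))) * c * g.len y ^ (-(4 : ℝ)) * g.len y' ^ (-(d : ℝ)) *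
          Real.exp (-(δ₁ / 2 * g.dist y y')) :=
  prop23_assembled_rw d hρ hsep hL hη hM hRM blk h260 hK hPr hα' hsize hκδ hB₁ hθ hδ₁ hsplit h261σ hthr h261
    h263 hc hc₃ hs hmg hBC hover hpf01 hph h236 hLip hcube hlev hgap h281 hCk0 h270 N hN hχ1 hpfχ hhχ hχN hGD hDG
    hχGw hGwχ (hasMajorant_of_entry0 blk G ιL E hB₁ hloc hval h267)
    (fun i => hasMajorant_of_entry0 blk (Gw i) ιL (Ew i) hB₁ hloc (hvalw i) (h267w i))
    hKGw hKG hpfdeep hhdeep hcQ hcQs hQ hQs hQχ hQsh hXdef hXwdef hM₀ hKM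

end Reassembly

/-! ## §4  The reading is consistent (and is the intended one) -/

section Model

/-- Two sites, L = η = M = 1, R = 0, d(a, b) = 1 for a ≠ b; `Loc` = the functions on the sites, `suppIn λ y′` = "λ
vanishes off y′", `supNorm λ` = max |λ| — the intended reading of (Loc, suppIn, supNorm). [folklore] -/
@[reducible] noncomputable def locGeo : B6.Geometry where
  Site := Bool
  fin := inferInstance
  scale := fun _ => 0
  dist := fun a b => if a = b then 0 else 1
  k := 0
  eta := 1
  L := 1
  R := 0
  M := 1
  Hyp21_22 := True
  Loc := Bool → ℝ
  suppIn := fun lam y' => ∀ x, x ≠ y' → lam x = 0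
  supNorm := fun lam => max |lam true| |lam false|
  l2Norm := fun _ => 0
  holder := fun _ _ => 0
  Cut := PUnit
  cutIn := fun _ _ => True
  cutH := fun _ _ => 0
  cutSup := fun _ => 0

/-- L^jη = 1 on the model. [folklore] -/
@[simp] theorem locGeo_len (a : locGeo.Site) : locGeo.len a = 1 := by simp [B6.Geometry.len]

/-- |λ(y)| ≤ max |λ(true)| |λ(false)|. [folklore] -/
theorem abs_le_supNorm (lam : Bool → ℝ) (y : Bool) : |lam y| ≤ max |lam true| |lam false| := by
  cases y
  · exact le_max_right _ _
  · exact le_max_left _ _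

/-- **THE READING HOLDS ON THE MODEL**: (hloc) with ιL = id, (hval) and the (2.67)₀ clause for G′ = 1 with
e₀(λ, y) = |λ(y)|, O(1) = 1, at any rate r. [folklore] -/
theorem locGeo_reading (r : ℝ) :
    (∀ (μ : locGeo.Site → ℝ) (y' : locGeo.Site) (B : ℝ), BlockSupp (fun u : locGeo.Site => u) μ y' B →
      ∃ lam : locGeo.Loc, (fun l : locGeo.Loc => (l : locGeo.Site → ℝ)) lam = μ ∧
        locGeo.suppIn lam y' ∧ locGeo.supNorm lam ≤ B) ∧
    (∀ (lam : locGeo.Loc) (x : locGeo.Site),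
      |(1 : Module.End ℝ (locGeo.Site → ℝ)) ((fun l : locGeo.Loc => (l : locGeo.Site → ℝ)) lam) x| ≤
        (fun (l : locGeo.Loc) (y : locGeo.Site) => |l y|) lam ((fun u : locGeo.Site => u) x)) ∧
    (∀ (lam : locGeo.Loc) (y y' : locGeo.Site), locGeo.suppIn lam y' →
      (fun (l : locGeo.Loc) (y : locGeo.Site) => |l y|) lam y ≤
        1 * B6.pref4 (locGeo.len y) 0 * Real.exp (-(r * locGeo.dist y y')) * locGeo.supNorm lam) := by
  refine ⟨fun μ y' B hμ => ⟨μ, rfl, fun x hx => hμ.off x hx, ?_⟩, fun lam x => ?_, fun lam y y' hs => ?_⟩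
  · show max |μ true| |μ false| ≤ B
    have hb : ∀ x : Bool, |μ x| ≤ B := fun x => by
      by_cases hx : x = y'
      · exact hμ.bound x hx
      · rw [hμ.off x hx, abs_zero]; exact hμ.nonneg
    exact max_le (hb true) (hb false)
  · exact le_rfl
  · show |lam y| ≤ 1 * B6.pref4 (locGeo.len y) 0 * Real.exp (-(r * locGeo.dist y y')) * max |lam true| |lam false|
    rw [pref4_zero, locGeo_len]
    by_cases hy : y = y'
    · subst hy
      simpa using abs_le_supNorm lam y
    · have h0 : lam y = 0 := hs y hy
      rw [h0, abs_zero]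
      have : 0 ≤ max |lam true| |lam false| := le_max_of_le_left (abs_nonneg _)
      positivity

/-- Hence, by the dictionary, the identity on the model has the (2.67)₁-shape majorant 1·(L^jη)²e^{−r d}: the three
reading hypotheses of `prop23_assembled_p22` are jointly satisfiable by their intended interpretation. [folklore] -/
theorem locGeo_majorant (r : ℝ) :
    HasMajorant (fun u : locGeo.Site => u) (1 : Module.End ℝ (locGeo.Site → ℝ))
      (fun a b => 1 * locGeo.len a ^ 2 * Real.exp (-(r * locGeo.dist a b))) := by
  obtain ⟨hloc, hval, h267⟩ := locGeo_reading r
  exact hasMajorant_of_entry0 (g := locGeo) (fun u : locGeo.Site => u) 1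
    (fun l : locGeo.Loc => (l : locGeo.Site → ℝ)) (fun (l : locGeo.Loc) (y : locGeo.Site) => |l y|)
    zero_le_one hloc hval h267

end Model

end Literature.MathematicalPhysics.QuantumFieldTheory.Balaban1983to89.B6Prop23MajorantInput
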